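/-
Copyright (c) 2026 the pub-hodgecm-mathlib formalisation cell (harness21).  Prover seat hodgecm-mathlib-LH7-p08 (g0) (re-dealt to strike line L3 `stub_N6nsDyadic` by director
s1969 (a)), Track A «(D-RAM) FOUR-FRAME» squad, helper lane on h413 = stmt-HodgeConjecture-24833 (count-neutral).  β-BOARD v1 row R8 ∕ (P5) «H `(2ρ,2ρ,2ρ)`», FILE 4b: the
character sums over the admissible classes that the BOUNDARY key `s_g = 2d − 2` needs — two shifted multiplicative sums (vanishing) and the ADDITIVE character sum
`Σ_{g adm} ω(1 + δg) = −q^{⌈ρ∕2⌉−1}·(1 + ω(1 − δ))` at the break `|δ| = |ϖ|^{2d−2}`.  2026-09-04.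
-/
import Summits.HodgeConjecture.HodgeConjecture.Theorems.F0P3cDyRamDiagonalKappaCoreHangingCharacterMaps   -- ★ κH (B1a) (LH4-p06 (g3)): `sum_normSign_eq_zero_of_repr_admissible`, `v_add_eq_one_of_lt`; brings the ★ ω-conductor toolkit
import Summits.HodgeConjecture.HodgeConjecture.Theorems.F0P3cDyRamDiagonalCoreHangingClasses            -- ★ (B) (LH4-p08 (g3)): `ncard_bad_representatives_eq`
import Summits.HodgeConjecture.HodgeConjecture.Theorems.F0P3cDyRamDiagonalKappaCoreHangingClass          -- ★ κH-A2 (LH4-p06 (g3)): `two_le_d_of_v_two_lt_one`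
import Mathlib.Algebra.BigOperators.Finprod
import Mathlib.Data.Set.Card
import HarnessLib

/-!
# Crux `H413`, line LH4 «(D-RAM) FOUR-FRAME» — (β) table, β-BOARD row R8 ∕ (P5), FILE 4b: «THE SHIFTED AND THE ADDITIVE CHARACTER SUMS OVER THE ADMISSIBLE CLASSES»

Cell `hodgecm-mathlib` (D-0151), FLOOR 0, crux item H413 = `stmt-HodgeConjecture-24833`, route `HCCMUnconditional`; squad F0∕P3c∕LH4.  THEOREMS ONLY (no `def`, no instance, no
notation, no `sorry`, default heartbeats); ★-only imports; lane `--supports stmt-HodgeConjecture-24833 --as helper` (count-neutral); pays NO row, states NO law.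

THE MATHEMATICS (this seat's H-ROW DERIVATION v1 e4da7f0103cc4a29 §3, the BOUNDARY key `s_g = L − m = 2d − 2`).  By FILE 4a the per-lattice value of the core-hanging lattice with
exact invariant `g` is `w∕2·(ω(g)ι, ι, ω(−(1+g)))·ε(g)` with `ε(g) = ω(g·g_α + g_β) = ω(g_α)·ω(g + c)`, `c = g_β∕g_α = 1 + δ`, `|δ| = |ϖ|^{2d−2}` at the boundary.  Summing over the
classes `g ∈ R`, `|1+g| = 1`, of a complete irredundant system `R` of representatives of the fixed units modulo `𝔭^ρ` therefore needs three sums: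
* §1 TRANSPORTS: for a fixed `c` with `|c − 1| < 1` (and `|2| < 1`: the residue characteristic is `2`, so `ḡ ∉ {0, 1}` is stable under `ḡ ↦ ḡ + 1`) the maps `g ↦ g + c` and `g ↦ c∕g`
  carry a complete irredundant system of representatives of the ADMISSIBLE fixed units `{|g| = |1+g| = 1}` to another one (★ κH (B1a) §3 pattern).
* §2 THE TWO SHIFTED SUMS VANISH in the alive window `2d−1 ≤ ρ`: `Σ_S ω(g + c) = 0` and `Σ_S ω(g)·ω(g + c) = Σ_S ω(1 + c∕g) = 0` (transport + ★ toolkit §5 `Σ_S ω = 0`).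
* §3 THE ADDITIVE CHARACTER SUM (any `ρ ≥ 1`): `ψ(x) := ω(1 + δx)` on the fixed integers is constant on residue classes, additive (`δ² ∈ 𝔭^{4d−4} ⊆ 𝔭^{2d−1}`), trivial on `𝔭`,
  and NON-trivial (★ toolkit §2: a fixed non-norm `c′ ≡ 1 (𝔭^{2d−2})`, `c′ = 1 + δc₀`).  On the full integer system `R₊ = R ⊔ (1 + R_bad)` (`R_bad = {g ∈ R : |1+g| < 1}`, ★ (B)
  `#R_bad = q^{⌈ρ∕2⌉−1}`) the translation `x ↦ rep(x + c₀)` is a `ψ`-flipping permutation, so `Σ_{R₊} ψ = 0`; removing the two residue classes `0̄` (`ψ = 1`) and `1̄ = −1̄` (`ψ = ω(1−δ)`):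
  **`Σ_{g ∈ R, |1+g| = 1} ω(1 + δg) = −q^{⌈ρ∕2⌉−1}·(1 + ω(1 − δ))`** — the «−1 − ψ₀(1)» of the derivation's boundary term (`= 0` or `−2q^{⌈ρ∕2⌉−1}`; at `q = 2` both sides vanish).
HONEST LABEL.  Count-neutral (`--supports`); the boundary H rows (FILE 4c ff.), the shallow keys, `hRest`, (T3), (β-BAL), (β), T₊ stay OPEN; `HC_CM` is proved only modulo the 7 printed
citations (2 remaining named inputs: hLiu418 = `stmt-HodgeConjecture-24832`, h413 = `stmt-HodgeConjecture-24833`) until rung 0 closes.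

## References
* [Kottwitz1986BaseChangeUnits] R. E. Kottwitz, *Base change for unit elements of Hecke algebras*, Compositio Math. 60 (1986), §1 pp. 240–241 (signed lattice counts modulo the torus).
* [Serre1979] J.-P. Serre, *Local Fields*, GTM 67 (1979), Ch. V §3 Prop. 5, Cor. 2–3 pp. 84–86; Ch. XV §2 (the conductor of the quadratic character; `U^{(d−1)}∕U^{(d)} ≅ k` additively).
* [Rogawski1990] J. D. Rogawski, *Automorphic Representations of Unitary Groups in Three Variables*, Ann. of Math. Stud. 123 (1990), §4.10 p. 58.
-/

set_option autoImplicit false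

noncomputable section

namespace Summit.HodgeConjecture.HodgeConjecture.Cruxes.H413.F0P3cDyRamAdmissibleShiftedCharacterSums

open WithZero Matrix
open Literature.NumberTheory.Automorphic.UnitaryThreeFourFrame
open Literature.NumberTheory.LocalFields.WildQuadraticDatum
open Summit.HodgeConjecture.HodgeConjecture.Cruxes.H413.F0P3cDyRamFixedCountDiagonalModel (normSign_mul_norm)
open Summit.HodgeConjecture.HodgeConjecture.Cruxes.H413.F0P3cDyRamDiagonalKappaCoreHangingCharacterMaps (v_add_eq_one_of_lt sum_normSign_eq_zero_of_repr_admissible)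
open Summit.HodgeConjecture.HodgeConjecture.Cruxes.H413.F0P3cDyRamDiagonalCoreHangingClasses (ncard_bad_representatives_eq)
open Summit.HodgeConjecture.HodgeConjecture.Cruxes.H413.F0P3cDyRamDiagonalKappaCoreHangingClass (two_le_d_of_v_two_lt_one)
open scoped Valued

variable {K : Type} [Field K] [Valued K ℤᵐ⁰]

/-! ## §0 Letters: the admissible letters of `g + c` and `c∕g` for `|c − 1| < 1`, `|2| < 1` -/

/-- For a fixed-free statement: `|g| = |1+g| = 1`, `|c − 1| < 1`, `|2| < 1` give `|g + c| = 1` and `|1 + (g + c)| = 1`. [cite: Serre1979, Ch. XV §2] -/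
theorem v_add_admissible (h2 : Valued.v (2 : K) < 1) {g c : K} (hg : Valued.v g = 1) (h1g : Valued.v (1 + g) = 1) (hc : Valued.v (c - 1) < 1) :
    Valued.v (g + c) = 1 ∧ Valued.v (1 + (g + c)) = 1 := by
  refine ⟨?_, ?_⟩
  · rw [show g + c = (1 + g) + (c - 1) by ring]; exact v_add_eq_one_of_lt h1g hc
  · rw [show 1 + (g + c) = g + (2 + (c - 1)) by ring]
    exact v_add_eq_one_of_lt hg ((Valuation.map_add _ _ _).trans_lt (max_lt h2 hc))

/-- `|g| = |1+g| = 1`, `|c − 1| < 1`, `|2| < 1` give `|c∕g| = 1` and `|1 + c∕g| = 1`. [cite: Serre1979, Ch. XV §2] -/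
theorem v_div_admissible (h2 : Valued.v (2 : K) < 1) {g c : K} (hg : Valued.v g = 1) (h1g : Valued.v (1 + g) = 1) (hc : Valued.v (c - 1) < 1) :
    Valued.v (c / g) = 1 ∧ Valued.v (1 + c / g) = 1 := by
  have hg0 : g ≠ 0 := fun h => by rw [h, map_zero] at hg; exact zero_ne_one hg
  have hc1 : Valued.v c = 1 := by rw [show c = 1 + (c - 1) by ring]; exact v_add_eq_one_of_lt (map_one _) hc
  refine ⟨by rw [map_div₀, hc1, hg, div_one], ?_⟩
  rw [show 1 + c / g = (g + c) / g by field_simp, map_div₀, (v_add_admissible h2 hg h1g hc).1, hg, div_one]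

/-! ## §1 Transport of an admissible representative system along `g ↦ g + c` and `g ↦ c∕g` -/

/-- The image of an admissible representative system under the translation `g ↦ g + c` (`c` fixed, `|c − 1| < 1`, `|2| < 1`) is again one. [cite: Kottwitz1986BaseChangeUnits, §1 pp. 240–241] -/
theorem repr_admissible_image_add [DecidableEq K] {σ : K →+* K} {ϖ : K} {ρ : ℕ} (h2 : Valued.v (2 : K) < 1) {c : K} (hσc : σ c = c) (hc : Valued.v (c - 1) < 1)
    (S : Finset K) (hS1 : ∀ g ∈ S, σ g = g ∧ Valued.v g = 1 ∧ Valued.v (1 + g) = 1)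
    (hS2 : ∀ f : K, σ f = f → Valued.v f = 1 → Valued.v (1 + f) = 1 → ∃ g ∈ S, Valued.v (f - g) ≤ Valued.v ϖ ^ ρ)
    (hS3 : ∀ g ∈ S, ∀ g' ∈ S, Valued.v (g - g') ≤ Valued.v ϖ ^ ρ → g = g') :
    (∀ h ∈ S.image (fun g => g + c), σ h = h ∧ Valued.v h = 1 ∧ Valued.v (1 + h) = 1) ∧
    (∀ f : K, σ f = f → Valued.v f = 1 → Valued.v (1 + f) = 1 → ∃ h ∈ S.image (fun g => g + c), Valued.v (f - h) ≤ Valued.v ϖ ^ ρ) ∧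
    (∀ h ∈ S.image (fun g => g + c), ∀ h' ∈ S.image (fun g => g + c), Valued.v (h - h') ≤ Valued.v ϖ ^ ρ → h = h') := by
  classical
  refine ⟨?_, ?_, ?_⟩
  · intro h hh
    obtain ⟨g, hg, rfl⟩ := Finset.mem_image.1 hh
    obtain ⟨hσg, hvg, h1g⟩ := hS1 g hg
    exact ⟨by rw [map_add, hσg, hσc], (v_add_admissible h2 hvg h1g hc).1, (v_add_admissible h2 hvg h1g hc).2⟩
  · intro f hσf hf h1f
    -- `f − c = f + (−c)`, `|−c − 1| = |c + 1| = |(c − 1) + 2| < 1`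
    have hnc : Valued.v (-c - 1) < 1 := by
      rw [show -c - 1 = -((c - 1) + 2) by ring, Valuation.map_neg]
      exact (Valuation.map_add _ _ _).trans_lt (max_lt hc h2)
    obtain ⟨hv1, hv2⟩ := v_add_admissible h2 hf h1f hnc
    obtain ⟨g, hg, hfg⟩ := hS2 (f + -c) (by rw [map_add, map_neg, hσf, hσc]) hv1 hv2
    refine ⟨g + c, Finset.mem_image_of_mem _ hg, ?_⟩
    rw [show f - (g + c) = f + -c - g by ring]; exact hfg
  · intro h hh h' hh' hle
    obtain ⟨g, hg, rfl⟩ := Finset.mem_image.1 hh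
    obtain ⟨g', hg', rfl⟩ := Finset.mem_image.1 hh'
    rw [show g + c - (g' + c) = g - g' by ring] at hle
    rw [hS3 g hg g' hg' hle]

/-- The image of an admissible representative system under `g ↦ c∕g` (`c` fixed, `|c − 1| < 1`, `|2| < 1`) is again one. [cite: Kottwitz1986BaseChangeUnits, §1 pp. 240–241] -/
theorem repr_admissible_image_div [DecidableEq K] {σ : K →+* K} {ϖ : K} {ρ : ℕ} (h2 : Valued.v (2 : K) < 1) {c : K} (hσc : σ c = c) (hc : Valued.v (c - 1) < 1)
    (S : Finset K) (hS1 : ∀ g ∈ S, σ g = g ∧ Valued.v g = 1 ∧ Valued.v (1 + g) = 1)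
    (hS2 : ∀ f : K, σ f = f → Valued.v f = 1 → Valued.v (1 + f) = 1 → ∃ g ∈ S, Valued.v (f - g) ≤ Valued.v ϖ ^ ρ)
    (hS3 : ∀ g ∈ S, ∀ g' ∈ S, Valued.v (g - g') ≤ Valued.v ϖ ^ ρ → g = g') :
    (∀ h ∈ S.image (fun g => c / g), σ h = h ∧ Valued.v h = 1 ∧ Valued.v (1 + h) = 1) ∧
    (∀ f : K, σ f = f → Valued.v f = 1 → Valued.v (1 + f) = 1 → ∃ h ∈ S.image (fun g => c / g), Valued.v (f - h) ≤ Valued.v ϖ ^ ρ) ∧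
    (∀ h ∈ S.image (fun g => c / g), ∀ h' ∈ S.image (fun g => c / g), Valued.v (h - h') ≤ Valued.v ϖ ^ ρ → h = h') := by
  classical
  have hc1 : Valued.v c = 1 := by rw [show c = 1 + (c - 1) by ring]; exact v_add_eq_one_of_lt (map_one _) hc
  have hc0 : c ≠ 0 := fun h => by rw [h, map_zero] at hc1; exact zero_ne_one hc1
  refine ⟨?_, ?_, ?_⟩
  · intro h hh
    obtain ⟨g, hg, rfl⟩ := Finset.mem_image.1 hh
    obtain ⟨hσg, hvg, h1g⟩ := hS1 g hg
    exact ⟨by rw [map_div₀, hσg, hσc], (v_div_admissible h2 hvg h1g hc).1, (v_div_admissible h2 hvg h1g hc).2⟩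
  · intro f hσf hf h1f
    have hf0 : f ≠ 0 := fun h => by rw [h, map_zero] at hf; exact zero_ne_one hf
    obtain ⟨hv1, hv2⟩ := v_div_admissible h2 hf h1f hc
    obtain ⟨g, hg, hfg⟩ := hS2 (c / f) (by rw [map_div₀, hσf, hσc]) hv1 hv2
    have hvg := (hS1 g hg).2.1
    have hg0 : g ≠ 0 := fun h => by rw [h, map_zero] at hvg; exact zero_ne_one hvg
    refine ⟨c / g, Finset.mem_image_of_mem _ hg, ?_⟩
    rw [show f - c / g = -(f / g) * (c / f - g) by field_simp; ring, map_mul, Valuation.map_neg, map_div₀, hf, hvg, div_one, one_mul]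
    exact hfg
  · intro h hh h' hh' hle
    obtain ⟨g, hg, rfl⟩ := Finset.mem_image.1 hh
    obtain ⟨g', hg', rfl⟩ := Finset.mem_image.1 hh'
    have hvg := (hS1 g hg).2.1
    have hvg' := (hS1 g' hg').2.1
    have hg0 : g ≠ 0 := fun h => by rw [h, map_zero] at hvg; exact zero_ne_one hvg
    have hg'0 : g' ≠ 0 := fun h => by rw [h, map_zero] at hvg'; exact zero_ne_one hvg'
    rw [show c / g - c / g' = -(c / (g * g')) * (g - g') by field_simp; ring, map_mul, Valuation.map_neg, map_div₀, map_mul, hc1, hvg, hvg',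
      mul_one, div_one, one_mul] at hle
    rw [hS3 g hg g' hg' hle]

/-! ## §2 The two shifted sums vanish in the alive window `2d−1 ≤ ρ` -/

/-- **`Σ_S ω(g + c) = 0`** over a complete irredundant system `S` of representatives modulo `𝔭^ρ` (`ρ ≥ 2d−1`) of the admissible fixed units, `c` fixed with `|c − 1| < 1` (§1 + ★ toolkit §5).
[cite: Serre1979, Ch. V §3 Cor. 3; Ch. XV §2] [cite: Kottwitz1986BaseChangeUnits, §1 pp. 240–241] -/
theorem sum_normSign_add_eq_zero [CompleteSpace K] [Finite 𝓀[K]] {σ : K →+* K} {ϖ : K} {d t : ℕ}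
    (hD : IsRamifiedQuadraticDatum σ ϖ d t) (h2 : Valued.v (2 : K) < 1) {ρ : ℕ} (hρ : 2 * d - 1 ≤ ρ) {c : K} (hσc : σ c = c) (hc : Valued.v (c - 1) < 1) (S : Finset K)
    (hS1 : ∀ g ∈ S, σ g = g ∧ Valued.v g = 1 ∧ Valued.v (1 + g) = 1)
    (hS2 : ∀ f : K, σ f = f → Valued.v f = 1 → Valued.v (1 + f) = 1 → ∃ g ∈ S, Valued.v (f - g) ≤ Valued.v ϖ ^ ρ)
    (hS3 : ∀ g ∈ S, ∀ g' ∈ S, Valued.v (g - g') ≤ Valued.v ϖ ^ ρ → g = g') :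
    ∑ g ∈ S, normSign σ (g + c) = 0 := by
  classical
  obtain ⟨h1, h2', h3⟩ := repr_admissible_image_add h2 hσc hc S hS1 hS2 hS3
  have hinj : Set.InjOn (fun g : K => g + c) ↑S := fun g _ g' _ h => by simpa using h
  rw [← Finset.sum_image hinj]
  exact sum_normSign_eq_zero_of_repr_admissible hD h2 hρ _ h1 h2' h3

/-- **`Σ_S ω(g)·ω(g + c) = 0`** (same hypotheses): `ω(g)ω(g+c) = ω(g·σg·(1 + c∕g)) = ω(1 + c∕g)` and `g ↦ c∕g` transports `S` (§1), then the previous sum with `c = 1`.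
[cite: Serre1979, Ch. V §3 Cor. 3; Ch. XV §2] [cite: Kottwitz1986BaseChangeUnits, §1 pp. 240–241] -/
theorem sum_normSign_mul_normSign_add_eq_zero [CompleteSpace K] [Finite 𝓀[K]] {σ : K →+* K} {ϖ : K} {d t : ℕ}
    (hD : IsRamifiedQuadraticDatum σ ϖ d t) (h2 : Valued.v (2 : K) < 1) {ρ : ℕ} (hρ : 2 * d - 1 ≤ ρ) {c : K} (hσc : σ c = c) (hc : Valued.v (c - 1) < 1) (S : Finset K)
    (hS1 : ∀ g ∈ S, σ g = g ∧ Valued.v g = 1 ∧ Valued.v (1 + g) = 1)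
    (hS2 : ∀ f : K, σ f = f → Valued.v f = 1 → Valued.v (1 + f) = 1 → ∃ g ∈ S, Valued.v (f - g) ≤ Valued.v ϖ ^ ρ)
    (hS3 : ∀ g ∈ S, ∀ g' ∈ S, Valued.v (g - g') ≤ Valued.v ϖ ^ ρ → g = g') :
    ∑ g ∈ S, normSign σ g * normSign σ (g + c) = 0 := by
  classical
  have hc1 : Valued.v c = 1 := by rw [show c = 1 + (c - 1) by ring]; exact v_add_eq_one_of_lt (map_one _) hc
  have hc0 : c ≠ 0 := fun h => by rw [h, map_zero] at hc1; exact zero_ne_one hc1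
  -- `ω(g)ω(g+c) = ω(1 + c∕g)`
  have hterm : ∀ g ∈ S, normSign σ g * normSign σ (g + c) = normSign σ (1 + c / g) := by
    intro g hg
    obtain ⟨hσg, hvg, h1g⟩ := hS1 g hg
    have hg0 : g ≠ 0 := fun h => by rw [h, map_zero] at hvg; exact zero_ne_one hvg
    have hgc0 : g + c ≠ 0 := fun h => by
      have := (v_add_admissible h2 hvg h1g hc).1; rw [h, map_zero] at this; exact zero_ne_one this
    rw [← normSign_mul_of_fixed hD hσg (by rw [map_add, hσg, hσc]) hg0 hgc0,
      show g * (g + c) = (1 + c / g) * (g * σ g) by rw [hσg]; field_simp, normSign_mul_norm σ _ hg0]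
  rw [Finset.sum_congr rfl hterm]
  obtain ⟨h1, h2', h3⟩ := repr_admissible_image_div h2 hσc hc S hS1 hS2 hS3
  have hinj : Set.InjOn (fun g : K => c / g) ↑S := by
    intro g hg g' hg' h
    have hvg := (hS1 g hg).2.1
    have hvg' := (hS1 g' hg').2.1
    have hg0 : g ≠ 0 := fun h0 => by rw [h0, map_zero] at hvg; exact zero_ne_one hvg
    have hg'0 : g' ≠ 0 := fun h0 => by rw [h0, map_zero] at hvg'; exact zero_ne_one hvg'
    have h' : c / g = c / g' := h
    rw [div_eq_div_iff hg0 hg'0] at h'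
    exact (mul_left_cancel₀ hc0 h').symm
  have hsum : ∑ g ∈ S, normSign σ (1 + c / g) = ∑ h ∈ S.image (fun g => c / g), normSign σ (h + 1) := by
    rw [Finset.sum_image hinj]
    exact Finset.sum_congr rfl fun g _ => by rw [add_comm]
  rw [hsum]
  exact sum_normSign_add_eq_zero hD h2 hρ (map_one σ) (by rw [sub_self, map_zero]; exact zero_lt_one) _ h1 h2' h3

end Summit.HodgeConjecture.HodgeConjecture.Cruxes.H413.F0P3cDyRamAdmissibleShiftedCharacterSums

end
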